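import Summits.AtomisticToContinuum.HydrodynamicLimit.Theorems.PreShockDoorKernel
import Summits.AtomisticToContinuum.HydrodynamicLimit.Theorems.PreShockDoorLocalEosStatics
import Literature.MathematicalPhysics.KineticTheory.HardSphereEulerSmoothFamiliesOfSymmHyperbolic
import Literature.MathematicalPhysics.KineticTheory.HardSphereEulerClassicalUniqueness
import Literature.Analysis.PDE.SymmHyperbolicSmoothFamiliesOfDim4
import HarnessLib

/-!
# `OneSphereInfluence.PreShockHomotopy` (stmt-AtomisticToContinuum-13621) from ONE named fact

The door of the PreShockDoor node (decomp-a2c lens-1 g40/g41/g42; critic rows 546 / 549 / 554 /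
558–561) with every provable piece discharged in the tree:

* `[S] LocalEosStatics` — PROVED: `localEosStatics_holds` (`PreShockDoorLocalEosStatics`);
* `[E] CoolSlowScaling`, `[I] LLNDataIdentification` — PROVED (`PreShockDoorScaling`, `…Pieces`);
* `[U]` classical uniqueness at small packing — the tree theorem
  `Literature.MathematicalPhysics.KineticTheory.hsEuler_uniqueness_smallPacking` (Dafermos Thm 5.2.1);
* `[WD] SmoothFamilyWellposedness` — KNOWN·ABSENT: it IS, verbatim, the Literature named fact
  `Literature.MathematicalPhysics.KineticTheory.hsEuler_smoothFamilyWellposedness`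
  (`HardSphereEulerSmoothFamilies.lean`), which in turn is DERIVED (PROVED reduction
  `hsEuler_smoothFamilyWellposedness_of_symmHyperbolic`, `HardSphereEulerSmoothFamiliesOfSymmHyperbolic.lean`)
  from the generic printed-shape named fact `Literature.Analysis.PDE.symmHyperbolic_smoothFamilies`
  (`SymmHyperbolicSmoothFamilies.lean`: Kato 1975 Thms II–III in the compact-spatial-section form of
  Valiente Kroon 2016 Thm 12.4, with the parameter principle, Hörmander 1997 p. 54).

HONEST LABEL. The two theorems below prove the route decl `Theses.OneSphereInfluence.PreShockHomotopy`
CONDITIONALLY on a named Literature fact taken as a hypothesis (D-0014 model: `proof.conditional`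
in the H21 audit). The item stmt-AtomisticToContinuum-13621 does NOT close by name through this file;
it closes the day `symmHyperbolic_smoothFamilies` (or directly `hsEuler_smoothFamilyWellposedness`)
is PROVED in the tree — then `preShockHomotopy_holds := preShockHomotopy_of_symmHyperbolic
symmHyperbolic_smoothFamilies_holds` is a one-liner to append here. The dependence OF RECORD is the
generic fact (critic row 558 (3)). Nothing about the summit `AtomisticToContinuum` is claimed.
-/

namespace Summit.AtomisticToContinuum.HydrodynamicLimit.Theorems.PreShockDoor

/-- `[WD]` IS the hard-sphere named fact `hsEuler_smoothFamilyWellposedness` (same statement,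
definitionally): transport of the hypothesis. [cite: Kato1975, Thms II–III] -/
theorem smoothFamilyWellposedness_of_fact
    (h : Literature.MathematicalPhysics.KineticTheory.hsEuler_smoothFamilyWellposedness) :
    SmoothFamilyWellposedness := h

/-- **`[WD]` from the generic named fact.** `SmoothFamilyWellposedness` follows from
`Literature.Analysis.PDE.symmHyperbolic_smoothFamilies` by the proved reduction
`hsEuler_smoothFamilyWellposedness_of_symmHyperbolic` (decomp-a2c lens-1 g42 kit (c″)).
[cite: Kato1975, Thms II–III] [cite: Dafermos2005, Thm 5.1.1] -/
theorem smoothFamilyWellposedness_of_symmHyperbolic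
    (H : Literature.Analysis.PDE.symmHyperbolic_smoothFamilies) : SmoothFamilyWellposedness :=
  Literature.MathematicalPhysics.KineticTheory.hsEuler_smoothFamilyWellposedness_of_symmHyperbolic H

/-- **`PreShockHomotopy` (stmt-AtomisticToContinuum-13621) from the hard-sphere named fact `[WD]`
alone** — CONDITIONAL result: the hypothesis is the unproved Literature fact
`hsEuler_smoothFamilyWellposedness` (Kato 1975 Thms II–III, family form); `[S]`, `[E]`, `[I]` are
theorems of the tree and `[U]` is `hsEuler_uniqueness_smallPacking`. -/
theorem preShockHomotopy_of_smoothFamilyWellposedness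
    (h : Literature.MathematicalPhysics.KineticTheory.hsEuler_smoothFamilyWellposedness) :
    Summit.AtomisticToContinuum.HydrodynamicLimit.Theses.OneSphereInfluence.PreShockHomotopy :=
  preShockHomotopy_door (smoothFamilyWellposedness_of_fact h) localEosStatics_holds

/-- **`PreShockHomotopy` (stmt-AtomisticToContinuum-13621) from the generic named fact
`Literature.Analysis.PDE.symmHyperbolic_smoothFamilies` alone** (the dependence of record) —
CONDITIONAL result; becomes `preShockHomotopy_holds` the day the fact is proved in the tree. -/
theorem preShockHomotopy_of_symmHyperbolic
    (H : Literature.Analysis.PDE.symmHyperbolic_smoothFamilies) :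
    Summit.AtomisticToContinuum.HydrodynamicLimit.Theses.OneSphereInfluence.PreShockHomotopy :=
  preShockHomotopy_of_smoothFamilyWellposedness
    (Literature.MathematicalPhysics.KineticTheory.hsEuler_smoothFamilyWellposedness_of_symmHyperbolic H)

/-- **`PreShockHomotopy` (stmt-AtomisticToContinuum-13621) from `[X₄]` ALONE** — CONDITIONAL
result, the new dependence of record: the hypothesis is the named Literature fact
`Literature.Analysis.PDE.SymmHyperbolicLocalExistenceDim 4` (single-datum smooth local existence
for quasilinear symmetric hyperbolic systems on `𝕋⁴`; Kato 1975 Thm II / Majda 1984 Thm 2.1 in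
`d = 4`, verbatim print; its `d = 3` instance is the tree theorem
`symmHyperbolicLocalExistenceDim_three`). Composition of the door of record
`preShockHomotopy_of_symmHyperbolic` with the PROVED ParameterAsDimension door
`Literature.Analysis.PDE.symmHyperbolic_smoothFamilies_of_dim4` (decomp-a2c lens-1 g43; critic
row 571 (2)(v)). Becomes `preShockHomotopy_holds` the day `SymmHyperbolicLocalExistenceDim 4` is
proved in the tree (generic re-type G1–G6 of the `𝕋³` energy chain with
`Literature.Analysis.FunctionSpaces.Torus.WordSupEmbedding`). Nothing about the summit is claimed. -/
theorem preShockHomotopy_of_dim4 (H4 : Literature.Analysis.PDE.SymmHyperbolicLocalExistenceDim 4) :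
    Summit.AtomisticToContinuum.HydrodynamicLimit.Theses.OneSphereInfluence.PreShockHomotopy :=
  preShockHomotopy_of_symmHyperbolic (Literature.Analysis.PDE.symmHyperbolic_smoothFamilies_of_dim4 H4)

end Summit.AtomisticToContinuum.HydrodynamicLimit.Theorems.PreShockDoor
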